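import Mathlib.RepresentationTheory.Homological.ContCohomology.Functoriality
import Mathlib.Topology.Algebra.Group.Quotient
import Mathlib.Topology.ContinuousOn
import Mathlib.GroupTheory.Index
import Mathlib.LinearAlgebra.Isomorphisms
import Mathlib.Tactic.Group
import Mathlib.Tactic.Abel
import Literature.NumberTheory.EllipticCurves.PeriodIndexCorestriction
import HarnessLib

/-!
# Restriction, conjugation and corestriction on continuous cohomology along subgroups,
# for arbitrary topological coefficients

Generic continuous group cohomology (no number theory).  Let `G` be a topological group and
`X : TopRep R G` a topological representation (Mathlib: a topological `R`-module with a
representation by continuous linear maps; **no discreteness** is assumed, so `X` may be a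
`p`-adic representation `T`).  For a subgroup `H ≤ G` we write `X|H = subgroupRep X H` for the
restricted representation (Mathlib `TopRep.res H.subtype X`) and
`Hⁿ(H, X) = continuousCohomology n (subgroupRep X H)` (Mathlib's continuous cohomology, computed
with homogeneous continuous cochains).  This file provides, with complete proofs:

* `resLe X h n : Hⁿ(H', X) ⟶ Hⁿ(H, X)` for `H ≤ H'` — **restriction** (Mathlib
  `ContinuousCohomology.map` along the inclusion);
* `conjMap X H g n : Hⁿ(H, X) ⟶ Hⁿ(H, X)` for `H` normal and `g ∈ G` — the **action of `G ⧸ H`**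
  (on cocycles `(g · φ)(h) = g • φ(g⁻¹ h g)`; Serre, *Local Fields*, VII.§5), again through
  `ContinuousCohomology.map` along the compatible pair `(h ↦ g⁻¹ h g, v ↦ g • v)`;
  `conjMap_oneCocycleClass` computes it on continuous crossed homomorphisms;
* the **transfer** on continuous crossed homomorphisms along an open subgroup `N ≤ G` of finite
  index and a system `s` of left coset representatives,
  `(cor f)(g) = Σ_{x ∈ G ⧸ N} s(g • x) • f(s(g • x)⁻¹ g s(x))` (`transferFun`, `transferCocycle`;
  Neukirch–Schmidt–Wingberg, *Cohomology of Number Fields*, I.§5), its continuity for arbitrary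
  topological coefficients (`continuous_transferFun`: `G ⧸ N` is discrete), and the
  **corestriction** `cores X N hN : H¹(N, X) →ₗ[R] H¹(G, X)` it induces (`liftH1ₗ`: linear maps out
  of `H¹` defined on cocycles; well defined by `transferFun_of_coboundary`; independent of the
  representatives, `coresWith_eq_coresWith`); `cores_resSubgroup : cor ∘ res = (G : N)`;
* the **relative corestriction** `coresLe X h hH : H¹(H, X) →ₗ[R] H¹(H', X)` for subgroups
  `H ≤ H'` of `G` with `H` open of finite index in `H'` (the transfer inside the group `H'` along
  `H.subgroupOf H'`, composed with the tautological identification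
  `H¹(H, X) → H¹(H.subgroupOf H', X)`).

This generalises, from discrete coefficient modules to arbitrary topological ones and from
`AddMonoidHom`s to `R`-linear maps, the degree-one toolkit of
`Literature/NumberTheory/EllipticCurves/{SubgroupSelmer, H1CorestrictionIndexTwo,
PeriodIndexCorestriction}` (`resOfLe`, `conjH1`, `liftH1`, `coresH1`, stated there for
`discreteTopRep G M`); the proofs are the same cocycle computations, and the purely
group-theoretic helpers (`schreierElt`, `repChange`, `subgroupInclusion`, `subgroupConj`) are
reused from there.  It is the cohomological
input of the norm (corestriction) relations of Euler systems for `p`-adic representations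
(`Literature/NumberTheory/GaloisRepresentations/EulerSystem`).  Mathlib has restriction
(`ContinuousCohomology.map`) but no corestriction for continuous cohomology.

## References

* J.-P. Serre, *Galois Cohomology* (1997), I.§2.4 (Res, Cor for an open subgroup of finite index,
  `Cor ∘ Res = n`), I.§2.5. [SerreGaloisCohomology1997]
* J.-P. Serre, *Local Fields* (1979), VII.§5 (the action of `G/H` on `H^q(H, A)`), VII.§7–§8
  (Cor, transfer). [SerreLocalFields1979]
* J. Neukirch, A. Schmidt, K. Wingberg, *Cohomology of Number Fields*, 2nd ed. (2008), I.§5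
  (cor on inhomogeneous cochains via coset representatives), II.§7 (continuous cochains).
  [NeukirchSchmidtWingberg2008]
* K. Rubin, *Euler Systems*, Annals of Math. Studies 147 (2000), Appendix B.2 (continuous
  cohomology of topological `G`-modules). [Rubin2000]

## Design notes

* Universes: `G : Type v` and `X : TopRep.{v} R G` share one universe (forced by Mathlib's
  `ContinuousCohomology.map`); subgroups of `G` are again in `Type v`.
* Continuity of the transfer needs no joint continuity of `G × X → X`: on each of the finitely
  many open pieces `{g | g • x = y}` of `G` the summand is `g ↦ s(y) • f(⋯)`, a fixed continuous
  linear map applied to a continuous function (`continuous_prod_of_discrete_left`).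
* As in `PeriodIndexCorestriction`, finite index is the instance argument `[Fintype (G ⧸ N)]`
  (consumers with an open subgroup of a compact group supply `Fintype.ofFinite _`).
-/

noncomputable section

open CategoryTheory

universe u v

namespace Literature.NumberTheory.GaloisRepresentations

open Literature.NumberTheory.EllipticCurves (schreierElt schreierElt_mem schreierElt_coe
  rep_mul_schreierElt schreierElt_mul rep_inv_mul_rep_mem repChange repChange_coe rep_mul_repChange
  subgroupInclusion subgroupInclusion_apply_coe subgroupConj subgroupConj_apply_coe conj_mem_of_normal)

variable {R : Type u} [Ring R] [TopologicalSpace R]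
variable {G : Type v} [Group G] [TopologicalSpace G] [IsTopologicalGroup G]

/-! ## Restriction to a subgroup; `Hⁿ(H, X)`; restriction maps -/

section Subgroup

variable (X : TopRep.{v} R G)

/-- The restriction `X|H` of a topological representation `X` of `G` to a subgroup `H ≤ G`
(Mathlib `TopRep.res` along `H.subtype`); its continuous cohomology
`continuousCohomology n (subgroupRep X H)` is `Hⁿ(H, X)`, and for `G = Γ_K`, `H = Gal(K̄/F)` it
is the continuous-cochain Galois cohomology `Hⁿ(F, X)`.
Ref: Serre, *Galois Cohomology* (1997), I.§2.2, I.§2.5; Rubin, *Euler Systems* (2000), App. B.2.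
[folklore] -/
abbrev subgroupRep (H : Subgroup G) : TopRep.{v} R H :=
  TopRep.res H.subtype X

omit [TopologicalSpace G] [IsTopologicalGroup G] in
/-- The action of `h ∈ H` on `X|H` is that of `h ∈ G`. [folklore] -/
@[simp]
theorem subgroupRep_ρ_apply (H : Subgroup G) (h : H) (v : X) :
    (subgroupRep X H).ρ h v = X.ρ (h : G) v :=
  rfl

/-- The **restriction map** `res : Hⁿ(H', X) ⟶ Hⁿ(H, X)` for subgroups `H ≤ H'` (functoriality
of continuous cohomology along the compatible pair `(H ↪ H', id_X)`).
Ref: Serre, *Galois Cohomology* (1997), I.§2.4–2.5. [folklore] -/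
def resLe {H H' : Subgroup G} (h : H ≤ H') (n : ℕ) :
    continuousCohomology n (subgroupRep X H') ⟶ continuousCohomology n (subgroupRep X H) :=
  ContinuousCohomology.map (subgroupInclusion h) (X := subgroupRep X H') (Y := subgroupRep X H)
    (TopRep.ofHom ⟨ContinuousLinearMap.id R X, fun _ => rfl⟩) n

/-- Restriction on explicit cocycles: `res [φ] = [φ|_H]`. [folklore] -/
theorem resLe_oneCocycleClass {H H' : Subgroup G} (h : H ≤ H')
    (φ : contOneCocycles (subgroupRep X H')) :
    resLe X h 1 (oneCocycleClass _ φ) =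
      oneCocycleClass (subgroupRep X H)
        (contOneCocycles.pullback (subgroupInclusion h)
          (TopRep.ofHom ⟨ContinuousLinearMap.id R X, fun _ => rfl⟩) φ) :=
  map_oneCocycleClass _ _ _ φ

/-- The inclusion `H ↪ G` of a subgroup as a continuous homomorphism. [folklore] -/
def subgroupSubtypeHom (H : Subgroup G) : H →ₜ* G where
  toMonoidHom := H.subtype
  continuous_toFun := continuous_subtype_val

omit [IsTopologicalGroup G] in
/-- Unfolding `subgroupSubtypeHom`. [folklore] -/
@[simp]
theorem subgroupSubtypeHom_apply (H : Subgroup G) (x : H) : subgroupSubtypeHom H x = (x : G) :=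
  rfl

/-- The restriction from the whole group: `res : Hⁿ(G, X) ⟶ Hⁿ(H, X)` along `H.subtype`.
Ref: Serre, *Galois Cohomology* (1997), I.§2.4. [folklore] -/
def resSubgroup (H : Subgroup G) (n : ℕ) :
    continuousCohomology n X ⟶ continuousCohomology n (subgroupRep X H) :=
  ContinuousCohomology.map (subgroupSubtypeHom H) (X := X) (Y := subgroupRep X H)
    (TopRep.ofHom ⟨ContinuousLinearMap.id R X, fun _ => rfl⟩) n

/-- `resSubgroup` on explicit cocycles: `res [φ] = [φ|_H]`. [folklore] -/
theorem resSubgroup_oneCocycleClass (H : Subgroup G) (φ : contOneCocycles X) :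
    resSubgroup X H 1 (oneCocycleClass X φ) =
      oneCocycleClass (subgroupRep X H)
        (contOneCocycles.pullback (subgroupSubtypeHom H) (Y := subgroupRep X H)
          (TopRep.ofHom ⟨ContinuousLinearMap.id R X, fun _ => rfl⟩) φ) :=
  map_oneCocycleClass _ _ _ φ

/-! ## The action of `G` on `Hⁿ(H, X)` for a normal subgroup `H` -/

omit [TopologicalSpace G] [IsTopologicalGroup G] in
/-- `X.ρ (a * b) v = X.ρ a (X.ρ b v)`. [folklore] -/
theorem ρ_mul_apply (a b : G) (v : X) : X.ρ (a * b) v = X.ρ a (X.ρ b v) := by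
  rw [map_mul]; rfl

omit [TopologicalSpace G] [IsTopologicalGroup G] in
/-- `X.ρ g (X.ρ g⁻¹ v) = v`. [folklore] -/
@[simp]
theorem ρ_apply_ρ_inv_apply (g : G) (v : X) : X.ρ g (X.ρ g⁻¹ v) = v := by
  rw [← ρ_mul_apply, mul_inv_cancel, map_one]; rfl

omit [TopologicalSpace G] [IsTopologicalGroup G] in
/-- `X.ρ g⁻¹ (X.ρ g v) = v`. [folklore] -/
@[simp]
theorem ρ_inv_apply_ρ_apply (g : G) (v : X) : X.ρ g⁻¹ (X.ρ g v) = v := by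
  rw [← ρ_mul_apply, inv_mul_cancel, map_one]; rfl

/-- The morphism `res_{g⁻¹(·)g} (X|H) ⟶ X|H` given by `v ↦ g • v`: the module half of the
compatible pair defining the action of `g` on `Hⁿ(H, X)`. [folklore] -/
def conjRepHom (H : Subgroup G) [H.Normal] (g : G) :
    TopRep.res (subgroupConj H g : H →* H) (subgroupRep X H) ⟶ subgroupRep X H :=
  TopRep.ofHom ⟨X.ρ g, fun x => by
    ext v
    change X.ρ g (X.ρ (g⁻¹ * x * g) v) = X.ρ x (X.ρ g v)
    rw [mul_assoc, ρ_mul_apply, ρ_apply_ρ_inv_apply, ρ_mul_apply]⟩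

/-- **The action of `g ∈ G` on `Hⁿ(H, X)`** for a normal subgroup `H`: the map induced by the
compatible pair `(H → H, x ↦ g⁻¹ x g; X → X, v ↦ g • v)`; on `1`-cocycles
`(g · φ)(x) = g • φ(g⁻¹ x g)` (`conjMap_oneCocycleClass`).  Elements of `H` act trivially, so this
is the action of `G ⧸ H`; for `G = Γ_K`, `H = Gal(K̄/F)` it is the `Gal(F/K)`-module structure of
`Hⁿ(F, X)`.
Ref: Serre, *Local Fields* (1979), VII.§5; Neukirch–Schmidt–Wingberg (2008), I.§5. [folklore] -/
def conjMap (H : Subgroup G) [H.Normal] (g : G) (n : ℕ) :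
    continuousCohomology n (subgroupRep X H) ⟶ continuousCohomology n (subgroupRep X H) :=
  ContinuousCohomology.map (subgroupConj H g) (conjRepHom X H g) n

/-- The action on explicit cocycles: `g · [φ] = [x ↦ g • φ(g⁻¹ x g)]`. [folklore] -/
theorem conjMap_oneCocycleClass (H : Subgroup G) [H.Normal] (g : G)
    (φ : contOneCocycles (subgroupRep X H)) :
    conjMap X H g 1 (oneCocycleClass _ φ) =
      oneCocycleClass _ (contOneCocycles.pullback (subgroupConj H g) (conjRepHom X H g) φ) :=
  map_oneCocycleClass _ _ _ φ

/-- Values of the conjugated cocycle: `(g · φ)(x) = g • φ(g⁻¹ x g)`. [folklore] -/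
@[simp]
theorem conj_pullback_apply (H : Subgroup G) [H.Normal] (g : G)
    (φ : contOneCocycles (subgroupRep X H)) (x : H) :
    (contOneCocycles.pullback (subgroupConj H g) (conjRepHom X H g) φ).1 x =
      X.ρ g (φ.1 (subgroupConj H g x)) :=
  rfl

end Subgroup

/-! ## Linear maps out of `H¹` defined on cocycles -/

section LiftH1

variable (X : TopRep.{v} R G) {Y : Type*} [AddCommGroup Y] [Module R Y]

/-- **Maps out of `H¹` defined on cocycles.** An `R`-linear map on continuous crossed
homomorphisms that kills those with trivial class descends to `H¹_cont(G, X) = Z¹/B¹`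
(`oneCocycleClassₗ` is onto, `oneCocycleClass_surjective`).
Ref: Serre, *Galois Cohomology* (1997), I.§2.2. [folklore] -/
def liftH1ₗ (φ : contOneCocycles X →ₗ[R] Y)
    (hφ : ∀ f, oneCocycleClass X f = 0 → φ f = 0) : continuousCohomology 1 X →ₗ[R] Y :=
  ((LinearMap.ker (oneCocycleClassₗ X)).liftQ φ fun f hf => hφ f hf).comp
    ((oneCocycleClassₗ X).quotKerEquivOfSurjective (oneCocycleClass_surjective X)).symm.toLinearMap

/-- `liftH1ₗ φ [f] = φ f`. [folklore] -/
@[simp]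
theorem liftH1ₗ_oneCocycleClass (φ : contOneCocycles X →ₗ[R] Y)
    (hφ : ∀ f, oneCocycleClass X f = 0 → φ f = 0) (f : contOneCocycles X) :
    liftH1ₗ X φ hφ (oneCocycleClass X f) = φ f := by
  unfold liftH1ₗ
  rw [LinearMap.coe_comp, Function.comp_apply, LinearEquiv.coe_toLinearMap,
    ← oneCocycleClassₗ_apply, LinearMap.quotKerEquivOfSurjective_symm_apply,
    Submodule.liftQ_apply]

end LiftH1

/-! ## The transfer on continuous crossed homomorphisms -/

section Transfer

variable (X : TopRep.{v} R G) (N : Subgroup G) [Fintype (G ⧸ N)] {s : G ⧸ N → G}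

omit [IsTopologicalGroup G] [Fintype (G ⧸ N)] in
/-- The crossed-homomorphism identity for a cocycle on the subgroup `N`. [folklore] -/
theorem subgroup_cocycle_mul (f : contOneCocycles (subgroupRep X N)) (a b : N) :
    f.1 (a * b) = f.1 a + X.ρ (a : G) (f.1 b) :=
  f.2 a b

omit [IsTopologicalGroup G] [Fintype (G ⧸ N)] in
/-- `f (a⁻¹) = -(a⁻¹ • f a)` for a cocycle on `N`. [folklore] -/
theorem subgroup_cocycle_inv (f : contOneCocycles (subgroupRep X N)) (a : N) :
    f.1 a⁻¹ = -(X.ρ ((a : G)⁻¹) (f.1 a)) := by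
  have h := f.2 a⁻¹ a
  rw [inv_mul_cancel, contOneCocycles.apply_one] at h
  rw [eq_neg_iff_add_eq_zero, h]
  rfl

omit [IsTopologicalGroup G] [Fintype (G ⧸ N)] in
/-- Values of a finite sum of cocycles. [folklore] -/
theorem sum_apply_val' {H : Type v} [Group H] [TopologicalSpace H] [IsTopologicalGroup H]
    (Y : TopRep.{v} R H) {ι : Type*} (S : Finset ι) (F : ι → contOneCocycles Y) (y : H) :
    (∑ i ∈ S, F i).1 y = ∑ i ∈ S, (F i).1 y := by
  induction S using Finset.cons_induction with
  | empty => simp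
  | cons a S ha ih => rw [Finset.sum_cons, Finset.sum_cons, Submodule.coe_add,
      ContinuousMap.add_apply, ih]

/-- The **transfer** of a continuous crossed homomorphism `f` on `N` to `G`, as a bare function:
`(cor f)(g) = Σ_{x ∈ G/N} s(g • x) • f(s(g • x)⁻¹ g s(x))`.
Neukirch–Schmidt–Wingberg (2008), I.§5 (corestriction on inhomogeneous cochains);
Serre, *Local Fields* (1979), VII.§7–§8. [folklore] -/
def transferFun (hs : ∀ x : G ⧸ N, (s x : G ⧸ N) = x) (f : contOneCocycles (subgroupRep X N))
    (g : G) : X :=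
  ∑ x : G ⧸ N, X.ρ (s (g • x)) (f.1 (schreierElt N hs g x))

omit [IsTopologicalGroup G] in
/-- Unfolding `transferFun`. [folklore] -/
theorem transferFun_apply (hs : ∀ x : G ⧸ N, (s x : G ⧸ N) = x)
    (f : contOneCocycles (subgroupRep X N)) (g : G) :
    transferFun X N hs f g = ∑ x : G ⧸ N, X.ρ (s (g • x)) (f.1 (schreierElt N hs g x)) :=
  rfl

omit [IsTopologicalGroup G] in
/-- **The transfer is a crossed homomorphism on `G`**: `F(g₁ g₂) = F(g₁) + g₁ • F(g₂)` (cocycle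
rule for the Schreier elements and reindexing along `x ↦ g₂ • x`).
Neukirch–Schmidt–Wingberg (2008), I.§5. [folklore] -/
theorem transferFun_mul (hs : ∀ x : G ⧸ N, (s x : G ⧸ N) = x)
    (f : contOneCocycles (subgroupRep X N)) (g₁ g₂ : G) :
    transferFun X N hs f (g₁ * g₂) =
      transferFun X N hs f g₁ + X.ρ g₁ (transferFun X N hs f g₂) := by
  simp only [transferFun_apply]
  have key : ∀ x : G ⧸ N,
      X.ρ (s ((g₁ * g₂) • x)) (f.1 (schreierElt N hs (g₁ * g₂) x)) =
        X.ρ (s (g₁ • (g₂ • x))) (f.1 (schreierElt N hs g₁ (g₂ • x))) +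
          X.ρ g₁ (X.ρ (s (g₂ • x)) (f.1 (schreierElt N hs g₂ x))) := fun x ↦ by
    rw [schreierElt_mul, subgroup_cocycle_mul, map_add, mul_smul g₁ g₂ x, ← ρ_mul_apply,
      rep_mul_schreierElt, ρ_mul_apply]
  rw [Finset.sum_congr rfl fun x _ ↦ key x, Finset.sum_add_distrib, map_sum]
  congr 1
  exact Equiv.sum_comp (MulAction.toPerm g₂)
    (fun y ↦ X.ρ (s (g₁ • y)) (f.1 (schreierElt N hs g₁ y)))

/-- **The transfer is continuous** for arbitrary topological coefficients: `N` is open, so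
`G ⧸ N` is discrete and `g ↦ (g • x, f(schreierElt g x))` is continuous into `(G ⧸ N) × X`, on
which `(y, v) ↦ s(y) • v` is continuous (`continuous_prod_of_discrete_left`; each `X.ρ (s y)` is
a continuous linear map). [folklore] -/
theorem continuous_transferFun (hN : IsOpen (N : Set G)) (hs : ∀ x : G ⧸ N, (s x : G ⧸ N) = x)
    (f : contOneCocycles (subgroupRep X N)) : Continuous (transferFun X N hs f) := by
  haveI : DiscreteTopology (G ⧸ N) := QuotientGroup.discreteTopology hN
  have hsm : ∀ x : G ⧸ N, Continuous fun g : G ↦ g • x := fun x ↦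
    continuous_id.smul continuous_const
  have hrep : ∀ x : G ⧸ N, Continuous fun g : G ↦ s (g • x) := fun x ↦
    continuous_of_discreteTopology.comp (hsm x)
  have hsch : ∀ x : G ⧸ N, Continuous fun g : G ↦ schreierElt N hs g x := fun x ↦
    Continuous.subtype_mk (((hrep x).inv.mul continuous_id).mul continuous_const)
      fun g ↦ schreierElt_mem N hs g x
  have hF : Continuous fun q : (G ⧸ N) × X ↦ X.ρ (s q.1) q.2 :=
    continuous_prod_of_discrete_left.mpr fun y ↦ (X.ρ (s y)).continuous
  have hsummand : ∀ x : G ⧸ N,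
      Continuous fun g : G ↦ X.ρ (s (g • x)) (f.1 (schreierElt N hs g x)) := fun x ↦
    hF.comp ((hsm x).prodMk (f.1.continuous.comp (hsch x)))
  change Continuous fun g : G ↦ ∑ x : G ⧸ N, X.ρ (s (g • x)) (f.1 (schreierElt N hs g x))
  exact continuous_finsetSum _ fun x _ ↦ hsummand x

/-- **Transfer on cocycles** along the open subgroup `N` of finite index, for the representatives
`s`: `transferFun` as a continuous crossed homomorphism `G → X`.
Serre, *Galois Cohomology* (1997), I.§2.4; Neukirch–Schmidt–Wingberg (2008), I.§5. [folklore] -/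
def transferCocycle (hN : IsOpen (N : Set G)) (hs : ∀ x : G ⧸ N, (s x : G ⧸ N) = x)
    (f : contOneCocycles (subgroupRep X N)) : contOneCocycles X :=
  ⟨⟨transferFun X N hs f, continuous_transferFun X N hN hs f⟩,
    fun g₁ g₂ ↦ transferFun_mul X N hs f g₁ g₂⟩

/-- Values of `transferCocycle`. [folklore] -/
@[simp]
theorem transferCocycle_apply (hN : IsOpen (N : Set G)) (hs : ∀ x : G ⧸ N, (s x : G ⧸ N) = x)
    (f : contOneCocycles (subgroupRep X N)) (g : G) :
    (transferCocycle X N hN hs f).1 g = transferFun X N hs f g :=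
  rfl

omit [IsTopologicalGroup G] in
/-- The transfer is additive in the cocycle. [folklore] -/
theorem transferFun_add (hs : ∀ x : G ⧸ N, (s x : G ⧸ N) = x)
    (f₁ f₂ : contOneCocycles (subgroupRep X N)) (g : G) :
    transferFun X N hs (f₁ + f₂) g = transferFun X N hs f₁ g + transferFun X N hs f₂ g := by
  rw [transferFun_apply, transferFun_apply, transferFun_apply, ← Finset.sum_add_distrib]
  refine Finset.sum_congr rfl fun x _ ↦ ?_
  rw [Submodule.coe_add, ContinuousMap.add_apply, map_add]

omit [IsTopologicalGroup G] in
/-- The transfer is `R`-homogeneous in the cocycle. [folklore] -/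
theorem transferFun_smul (hs : ∀ x : G ⧸ N, (s x : G ⧸ N) = x) (r : R)
    (f : contOneCocycles (subgroupRep X N)) (g : G) :
    transferFun X N hs (r • f) g = r • transferFun X N hs f g := by
  rw [transferFun_apply, transferFun_apply, Finset.smul_sum]
  refine Finset.sum_congr rfl fun x _ ↦ ?_
  rw [Submodule.coe_smul, ContinuousMap.smul_apply, map_smul]

/-- Transfer on cocycles as an `R`-linear map `Z¹(N, X) → Z¹(G, X)`. [folklore] -/
def transferCocycleₗ (hN : IsOpen (N : Set G)) (hs : ∀ x : G ⧸ N, (s x : G ⧸ N) = x) :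
    contOneCocycles (subgroupRep X N) →ₗ[R] contOneCocycles X where
  toFun := transferCocycle X N hN hs
  map_add' f₁ f₂ := Subtype.ext (ContinuousMap.ext fun g ↦ transferFun_add X N hs f₁ f₂ g)
  map_smul' r f := Subtype.ext (ContinuousMap.ext fun g ↦ transferFun_smul X N hs r f g)

/-- `transferCocycleₗ` is `transferCocycle`. [folklore] -/
@[simp]
theorem transferCocycleₗ_apply (hN : IsOpen (N : Set G)) (hs : ∀ x : G ⧸ N, (s x : G ⧸ N) = x)
    (f : contOneCocycles (subgroupRep X N)) :
    transferCocycleₗ X N hN hs f = transferCocycle X N hN hs f :=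
  rfl

omit [IsTopologicalGroup G] in
/-- **The transfer of a coboundary is a coboundary**: if `f(n) = n • v - v` on `N` then
`(cor f)(g) = g • v' - v'` with `v' = Σ_x s(x) • v`. Neukirch–Schmidt–Wingberg (2008), I.§5.
[folklore] -/
theorem transferFun_of_coboundary (hs : ∀ x : G ⧸ N, (s x : G ⧸ N) = x)
    (f : contOneCocycles (subgroupRep X N)) (v : X)
    (hv : ∀ n : N, f.1 n = X.ρ (n : G) v - v) (g : G) :
    transferFun X N hs f g =
      X.ρ g (∑ x : G ⧸ N, X.ρ (s x) v) - ∑ x : G ⧸ N, X.ρ (s x) v := by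
  rw [transferFun_apply]
  have key : ∀ x : G ⧸ N, X.ρ (s (g • x)) (f.1 (schreierElt N hs g x)) =
      X.ρ g (X.ρ (s x) v) - X.ρ (s (g • x)) v := fun x ↦ by
    rw [hv, map_sub, ← ρ_mul_apply, rep_mul_schreierElt, ρ_mul_apply]
  rw [Finset.sum_congr rfl fun x _ ↦ key x, Finset.sum_sub_distrib, map_sum]
  congr 1
  exact Equiv.sum_comp (MulAction.toPerm g) (fun y ↦ X.ρ (s y) v)

/-- **Corestriction** `cor : H¹(N, X) →ₗ[R] H¹(G, X)` along the open subgroup `N` of finite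
index, computed with the representatives `s` (well defined on classes by
`transferFun_of_coboundary`; independent of `s` by `coresWith_eq_coresWith`).
Serre, *Galois Cohomology* (1997), I.§2.4; *Local Fields* (1979), VII.§7;
Neukirch–Schmidt–Wingberg (2008), I.§5. [folklore] -/
def coresWith (hN : IsOpen (N : Set G)) (hs : ∀ x : G ⧸ N, (s x : G ⧸ N) = x) :
    continuousCohomology 1 (subgroupRep X N) →ₗ[R] continuousCohomology 1 X :=
  liftH1ₗ (subgroupRep X N) ((oneCocycleClassₗ X).comp (transferCocycleₗ X N hN hs))
    fun f hf ↦ by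
    obtain ⟨v, hv⟩ := (oneCocycleClass_eq_zero_iff _ f).mp hf
    rw [LinearMap.coe_comp, Function.comp_apply, transferCocycleₗ_apply, oneCocycleClassₗ_apply,
      oneCocycleClass_eq_zero_iff]
    refine ⟨∑ x : G ⧸ N, X.ρ (s x) v, fun g ↦ ?_⟩
    rw [transferCocycle_apply]
    exact transferFun_of_coboundary X N hs f v (fun n ↦ hv n) g

/-- `cor_s [f] = [transferCocycle_s f]`. [folklore] -/
@[simp]
theorem coresWith_oneCocycleClass (hN : IsOpen (N : Set G))
    (hs : ∀ x : G ⧸ N, (s x : G ⧸ N) = x) (f : contOneCocycles (subgroupRep X N)) :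
    coresWith X N hN hs (oneCocycleClass _ f) = oneCocycleClass X (transferCocycle X N hN hs f) := by
  rw [coresWith, liftH1ₗ_oneCocycleClass]
  rfl

/-! ## Independence of the coset representatives -/

omit [IsTopologicalGroup G] in
/-- **Changing the representatives changes the transfer by a coboundary**: with
`η(x) = s(x)⁻¹ s'(x) ∈ N` and `w = Σ_x s(x) • f(η(x))`,
`(cor_{s'} f)(g) = (cor_s f)(g) + (g • w - w)`. Neukirch–Schmidt–Wingberg (2008), I.§5.
[folklore] -/
theorem transferFun_eq_transferFun_add (hs : ∀ x : G ⧸ N, (s x : G ⧸ N) = x) {s' : G ⧸ N → G}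
    (hs' : ∀ x : G ⧸ N, (s' x : G ⧸ N) = x) (f : contOneCocycles (subgroupRep X N)) (g : G) :
    transferFun X N hs' f g = transferFun X N hs f g +
      (X.ρ g (∑ x : G ⧸ N, X.ρ (s x) (f.1 (repChange N hs hs' x))) -
        ∑ x : G ⧸ N, X.ρ (s x) (f.1 (repChange N hs hs' x))) := by
  -- `schreierElt' g x = η(g • x)⁻¹ · schreierElt g x · η(x)`
  have hsch : ∀ x, schreierElt N hs' g x =
      (repChange N hs hs' (g • x))⁻¹ * (schreierElt N hs g x * repChange N hs hs' x) :=
    fun x ↦ by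
    apply Subtype.ext
    simp only [schreierElt_coe, Subgroup.coe_mul, Subgroup.coe_inv, repChange_coe, mul_inv_rev,
      inv_inv]
    group
  have key : ∀ x : G ⧸ N, X.ρ (s' (g • x)) (f.1 (schreierElt N hs' g x)) =
      -(X.ρ (s (g • x)) (f.1 (repChange N hs hs' (g • x)))) +
        X.ρ (s (g • x)) (f.1 (schreierElt N hs g x)) +
          X.ρ g (X.ρ (s x) (f.1 (repChange N hs hs' x))) := fun x ↦ by
    rw [hsch, subgroup_cocycle_mul, subgroup_cocycle_mul, subgroup_cocycle_inv,
      ← rep_mul_repChange N hs hs' (g • x)]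
    simp only [map_add, map_neg, ← ρ_mul_apply, Subgroup.coe_inv, mul_assoc,
      mul_inv_cancel_left, mul_inv_cancel, mul_one, rep_mul_schreierElt]
    abel
  have hre : ∑ x : G ⧸ N, X.ρ (s (g • x)) (f.1 (repChange N hs hs' (g • x))) =
      ∑ y : G ⧸ N, X.ρ (s y) (f.1 (repChange N hs hs' y)) :=
    Equiv.sum_comp (MulAction.toPerm g) (fun y ↦ X.ρ (s y) (f.1 (repChange N hs hs' y)))
  rw [transferFun_apply, transferFun_apply, Finset.sum_congr rfl fun x _ ↦ key x,
    Finset.sum_add_distrib, Finset.sum_add_distrib, Finset.sum_neg_distrib, map_sum, hre]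
  abel

/-- **Corestriction does not depend on the coset representatives.**
Serre, *Galois Cohomology* (1997), I.§2.4; Neukirch–Schmidt–Wingberg (2008), I.§5. [folklore] -/
theorem coresWith_eq_coresWith (hN : IsOpen (N : Set G))
    (hs : ∀ x : G ⧸ N, (s x : G ⧸ N) = x) {s' : G ⧸ N → G}
    (hs' : ∀ x : G ⧸ N, (s' x : G ⧸ N) = x) :
    coresWith X N hN hs' = coresWith X N hN hs := by
  refine LinearMap.ext fun ξ ↦ ?_
  obtain ⟨f, rfl⟩ := oneCocycleClass_surjective _ ξ
  rw [coresWith_oneCocycleClass, coresWith_oneCocycleClass, ← sub_eq_zero,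
    ← oneCocycleClass_sub, oneCocycleClass_eq_zero_iff]
  refine ⟨∑ x : G ⧸ N, X.ρ (s x) (f.1 (repChange N hs hs' x)), fun g ↦ ?_⟩
  rw [Submodule.coe_sub, ContinuousMap.sub_apply, transferCocycle_apply, transferCocycle_apply,
    transferFun_eq_transferFun_add X N hs hs' f g]
  abel

/-- **Corestriction** `cor : H¹(N, X) →ₗ[R] H¹(G, X)` along the open subgroup `N` of finite index
(representatives `Quotient.out`; any other system gives the same map, `coresWith_eq_cores`).
Serre, *Galois Cohomology* (1997), I.§2.4; *Local Fields* (1979), VII.§7;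
Neukirch–Schmidt–Wingberg (2008), I.§5. [folklore] -/
def cores (hN : IsOpen (N : Set G)) :
    continuousCohomology 1 (subgroupRep X N) →ₗ[R] continuousCohomology 1 X :=
  coresWith X N hN (s := Quotient.out) QuotientGroup.out_eq'

/-- Every system of representatives computes `cores`. [folklore] -/
theorem coresWith_eq_cores (hN : IsOpen (N : Set G)) (hs : ∀ x : G ⧸ N, (s x : G ⧸ N) = x) :
    coresWith X N hN hs = cores X N hN :=
  coresWith_eq_coresWith X N hN QuotientGroup.out_eq' hs

/-- `cor [f] = [transferCocycle_s f]` for every system of representatives `s`. [folklore] -/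
theorem cores_oneCocycleClass (hN : IsOpen (N : Set G)) (hs : ∀ x : G ⧸ N, (s x : G ⧸ N) = x)
    (f : contOneCocycles (subgroupRep X N)) :
    cores X N hN (oneCocycleClass _ f) = oneCocycleClass X (transferCocycle X N hN hs f) := by
  rw [← coresWith_eq_cores X N hN hs, coresWith_oneCocycleClass]

/-! ## `cor ∘ res = (G : N)` -/

omit [IsTopologicalGroup G] [Fintype (G ⧸ N)] in
/-- Values of the restriction to `N` of a cocycle on `G`. [folklore] -/
@[simp]
theorem resSubgroup_pullback_apply (f : contOneCocycles X) (n : N) :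
    (contOneCocycles.pullback (subgroupSubtypeHom N)
      (Y := subgroupRep X N) (TopRep.ofHom ⟨ContinuousLinearMap.id R X, fun _ => rfl⟩) f).1 n =
      f.1 n :=
  rfl

/-- **`cor ∘ res = (G : N)`** on `H¹_cont(G, X)`: on cocycles, the transfer of `f|_N` is
`(G : N) • f + ∂(Σ_x f(s x))`. Serre, *Galois Cohomology* (1997), I.§2.4 (Prop. 9);
*Local Fields* (1979), VII.§7, Prop. 6. [folklore] -/
theorem cores_resSubgroup (hN : IsOpen (N : Set G)) (η : continuousCohomology 1 X) :
    cores X N hN (resSubgroup X N 1 η) = (N.index : R) • η := by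
  obtain ⟨f, rfl⟩ := oneCocycleClass_surjective _ η
  set s : G ⧸ N → G := Quotient.out
  have hs : ∀ x : G ⧸ N, (s x : G ⧸ N) = x := QuotientGroup.out_eq'
  have hidx : (N.index : R) = (Fintype.card (G ⧸ N) : R) := by
    rw [Subgroup.index_eq_card, Nat.card_eq_fintype_card]
  rw [resSubgroup_oneCocycleClass, cores_oneCocycleClass X N hN hs, hidx, ← oneCocycleClass_smul,
    ← sub_eq_zero, ← oneCocycleClass_sub, oneCocycleClass_eq_zero_iff]
  refine ⟨∑ x : G ⧸ N, f.1 (s x), fun g ↦ ?_⟩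
  rw [Submodule.coe_sub, ContinuousMap.sub_apply, transferCocycle_apply, transferFun_apply,
    Submodule.coe_smul, ContinuousMap.smul_apply, Nat.cast_smul_eq_nsmul]
  have hx : ∀ x : G ⧸ N, X.ρ (s (g • x))
      ((contOneCocycles.pullback (subgroupSubtypeHom N)
        (Y := subgroupRep X N) (TopRep.ofHom ⟨ContinuousLinearMap.id R X, fun _ => rfl⟩) f).1
        (schreierElt N hs g x)) =
      f.1 g + (X.ρ g (f.1 (s x)) - f.1 (s (g • x))) := fun x ↦ by
    rw [resSubgroup_pullback_apply, schreierElt_coe, f.2, f.2, map_add, map_add, ← ρ_mul_apply,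
      ← ρ_mul_apply, mul_inv_cancel_left, mul_inv_cancel, map_one, one_apply_eq_self]
    have h1 : f.1 (s (g • x))⁻¹ = -(X.ρ (s (g • x))⁻¹ (f.1 (s (g • x)))) := by
      have h := f.2 (s (g • x))⁻¹ (s (g • x))
      rw [inv_mul_cancel, contOneCocycles.apply_one] at h
      rw [eq_neg_iff_add_eq_zero, h]
    rw [h1, map_neg, ρ_apply_ρ_inv_apply]
    abel
  have hre : ∑ x : G ⧸ N, f.1 (s (g • x)) = ∑ y : G ⧸ N, f.1 (s y) :=
    Equiv.sum_comp (MulAction.toPerm g) (fun y ↦ f.1 (s y))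
  rw [Finset.sum_congr rfl fun x _ ↦ hx x, Finset.sum_add_distrib, Finset.sum_const,
    Finset.card_univ, Finset.sum_sub_distrib, map_sum, hre]
  abel

end Transfer

/-! ## Relative corestriction `H¹(H, X) → H¹(H', X)` for `H ≤ H'` -/

section Relative

variable (X : TopRep.{v} R G) {H H' : Subgroup G}

omit [IsTopologicalGroup G] in
variable (H') in
/-- `H`, open in `G`, is open in `H'` as the subgroup `H.subgroupOf H'`. [folklore] -/
theorem isOpen_subgroupOf (hH : IsOpen (H : Set G)) :
    IsOpen (H.subgroupOf H' : Set H') :=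
  hH.preimage continuous_subtype_val

/-- The tautological continuous isomorphism `H.subgroupOf H' → H` (`Subgroup.subgroupOfEquivOfLe`)
as a continuous homomorphism. [folklore] -/
def subgroupOfHom (h : H ≤ H') : H.subgroupOf H' →ₜ* H where
  toMonoidHom := (Subgroup.subgroupOfEquivOfLe h).toMonoidHom
  continuous_toFun :=
    Continuous.subtype_mk (continuous_subtype_val.comp continuous_subtype_val) _

omit [IsTopologicalGroup G] in
/-- Unfolding `subgroupOfHom`. [folklore] -/
@[simp]
theorem subgroupOfHom_apply_coe (h : H ≤ H') (x : H.subgroupOf H') :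
    ((subgroupOfHom h x : H) : G) = ((x : H') : G) :=
  rfl

/-- The tautological comparison `H¹(H, X) ⟶ H¹(H.subgroupOf H', X|H')` (pull-back along
`subgroupOfHom`, identity on `X`). [folklore] -/
def toSubgroupOf (h : H ≤ H') (n : ℕ) :
    continuousCohomology n (subgroupRep X H) ⟶
      continuousCohomology n (subgroupRep (subgroupRep X H') (H.subgroupOf H')) :=
  ContinuousCohomology.map (subgroupOfHom h) (X := subgroupRep X H)
    (Y := subgroupRep (subgroupRep X H') (H.subgroupOf H'))
    (TopRep.ofHom ⟨ContinuousLinearMap.id R X, fun _ => rfl⟩) n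

/-- **Relative corestriction** `cor_{H'/H} : H¹(H, X) →ₗ[R] H¹(H', X)` for subgroups `H ≤ H'` of
`G` with `H` open and of finite index in `H'`: the corestriction of the group `H'` along its open
subgroup `H.subgroupOf H'`, after the tautological identification `toSubgroupOf`.  For `G = Γ_K`,
`H' = Gal(K̄/F) ≥ H = Gal(K̄/F')` this is `Cor_{F'/F} : H¹(F', X) → H¹(F, X)`.
Serre, *Galois Cohomology* (1997), I.§2.4; Rubin, *Euler Systems* (2000), App. B.2. [folklore] -/
def coresLe (h : H ≤ H') (hH : IsOpen (H : Set G)) [Fintype (H' ⧸ H.subgroupOf H')] :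
    continuousCohomology 1 (subgroupRep X H) →ₗ[R] continuousCohomology 1 (subgroupRep X H') :=
  (cores (subgroupRep X H') (H.subgroupOf H') (isOpen_subgroupOf H' hH)).comp
    (toSubgroupOf X h 1).hom.toLinearMap

/-- `coresLe` on explicit cocycles: `cor_{H'/H} [φ] = [transferCocycle_s (φ ∘ subgroupOfHom)]` for
every system `s` of representatives of `H' ⧸ H`. [folklore] -/
theorem coresLe_oneCocycleClass (h : H ≤ H') (hH : IsOpen (H : Set G))
    [Fintype (H' ⧸ H.subgroupOf H')] {s : H' ⧸ H.subgroupOf H' → H'}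
    (hs : ∀ x, (s x : H' ⧸ H.subgroupOf H') = x) (φ : contOneCocycles (subgroupRep X H)) :
    coresLe X h hH (oneCocycleClass _ φ) =
      oneCocycleClass (subgroupRep X H')
        (transferCocycle (subgroupRep X H') (H.subgroupOf H') (isOpen_subgroupOf H' hH) hs
          (contOneCocycles.pullback (subgroupOfHom h)
            (Y := subgroupRep (subgroupRep X H') (H.subgroupOf H'))
            (TopRep.ofHom ⟨ContinuousLinearMap.id R X, fun _ => rfl⟩) φ)) := by
  rw [coresLe, LinearMap.coe_comp, Function.comp_apply, ContinuousLinearMap.coe_coe]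
  change cores _ _ _ (toSubgroupOf X h 1 (oneCocycleClass _ φ)) = _
  rw [toSubgroupOf, map_oneCocycleClass, cores_oneCocycleClass _ _ _ hs]

end Relative

end Literature.NumberTheory.GaloisRepresentations

end
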